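import Literature.NumberTheory.Connes2026.AnnulusScalingSupport
import HarnessLib

/-!
# Connes 1999 Thm VII.4, `k = ℚ` — the trace integral of the annulus road:
# `∫_v k_f^{Q'}(y, v) k_ψ^{Q}(v, y) dv = |y|⁻¹ 1_Q(y) ∫ f(τ)ψ(−τ) dτ` and `∫_Q dy/|y| = 2 log(b/a)`

LABEL (line 1): RH-FREE literature (theorems only; NO definition, NO named fact).  bears_on: LADDER-RH
W-C/W-P (C1 named-fact debt), cell `rh-crit`, sub-cell cc, overflow row O1 — the explicit integral behind the
trace VALUE `Tr(ϑ(h) Q_{a,b})|_ev = h(0) log(b/a)` of the "annulus road" under `Connes1999_thm_VII_4_rat`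
(with `EvenPartKernel`, `EvenPartProjection.tsum_inner_evenPart_eq`, `L2KernelPairing.hasSum_inner_op_op_integral`
and the Dixmier–Malliavin split `h = Σ_r f_r ⋆ ψ_r`).  WHAT THIS IS NOT: any claim about positivity, Weil's
criterion or RH.

Sources.  A. Connes, Selecta Math. 5 (1999) [`Connes1999`], §VII proof of Thm 4, eqs. (29)–(33) (held text
`paper:arxiv-math_9811068`, p0013: the trace of the annulus piece is `log p · g(k log p)`, computed from the
kernel in the variables `(v, e^{−τ}v)`); A. Connes, C. Consani (2021) [`ConnesConsani2021`], §4 eq. (40)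
(`k_g(v,y) = g(log(v/y)) (vy)^{−1/2}`, tree `scalingKernel`, `integral_scalingKernel_mul`).

## What is proved

* **`integral_scalingKernel_mul_mul_scalingKernel`** — for `y ≠ 0` and any `f, ψ, F`:
  `∫ k_f(y, v) F(v) k_ψ(v, y) dv = |y|⁻¹ ∫ f(τ) ψ(−τ) F(e^{−τ}y) dτ` (substitution `v = e^{−τ}y`);
* `integral_shellScalingKernel_mul_shellScalingKernel` — with `F = 1_{Q'}`, `Q' ⊇ e^{−supp f} Q`, `y ∈ Q = Q_{a,b}`:
  `∫ k_f^{Q'}(y, v) k_ψ^{Q}(v, y) dv = |y|⁻¹ ∫ f(τ)ψ(−τ) dτ`, and `= 0` for `y ∉ Q`;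
* **`integral_shellSet_abs_inv`** — `∫_{Q_{a,b}} dy/|y| = 2 log(b/a)` (`0 < a ≤ b`);
* **`integral_integral_shellScalingKernel_mul`** — `∫ (∫ k_f^{Q'}(y,v) k_ψ^{Q}(v,y) dv) dy = 2 log(b/a) ∫ f(τ)ψ(−τ) dτ`.

No instance, notation or attribute; no `def`.
-/

noncomputable section

open _root_.MeasureTheory Complex Set Filter Function
open scoped Real Topology ComplexConjugate InnerProductSpace

namespace Literature.NumberTheory.Connes2026

open Literature.NumberTheory.LFunctions Literature.Analysis.OperatorTheory
open Literature.NumberTheory.ConnesConsani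
open Literature.NumberTheory.ConnesConsani2024
open Literature.NumberTheory.ConnesConsani2021

/-! ## §1. The inner integral (substitution `v = e^{−τ} y`) -/

/-- **`∫ k_f(y, v) F(v) k_ψ(v, y) dv = |y|⁻¹ ∫ f(τ) ψ(−τ) F(e^{−τ}y) dτ`** for `y ≠ 0`
(`k_ψ(e^{−τ}y, y) = ψ(−τ) e^{τ/2}/|y|`). [cite: Connes1999, §VII proof of Thm 4 eqs. (29)–(33) (arXiv p0013); ConnesConsani2021, §4 eq. (40) p. 15] -/
theorem integral_scalingKernel_mul_mul_scalingKernel (f ψ F : ℝ → ℂ) {y : ℝ} (hy : y ≠ 0) :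
    ∫ v, scalingKernel f y v * (F v * scalingKernel ψ v y) =
      ((|y|⁻¹ : ℝ) : ℂ) * ∫ τ, f τ * ψ (-τ) * F (Real.exp (-τ) * y) := by
  rw [integral_scalingKernel_mul hy, ← integral_const_mul]
  refine integral_congr_ae (ae_of_all _ fun τ => ?_)
  have hyy : 0 < y * y := mul_self_pos.mpr hy
  have hpos : 0 < Real.exp (-τ) * y * y := by
    rw [mul_assoc]; exact mul_pos (Real.exp_pos _) hyy
  have hlog : Real.log (Real.exp (-τ) * y / y) = -τ := by
    rw [mul_div_assoc, div_self hy, mul_one, Real.log_exp]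
  have h2 : (Real.exp (-τ / 2) * |y|) ^ 2 = Real.exp (-τ) * y * y := by
    rw [mul_pow, sq_abs, sq, ← Real.exp_add, show -τ / 2 + -τ / 2 = -τ by ring]; ring
  have hsqrt : Real.sqrt (Real.exp (-τ) * y * y) = Real.exp (-τ / 2) * |y| := by
    rw [← h2, Real.sqrt_sq (by positivity)]
  simp only []
  rw [scalingKernel_of_pos hpos, hlog, hsqrt]
  have hexp : (Real.exp (-τ / 2) : ℂ) * (((Real.exp (-τ / 2) * |y|)⁻¹ : ℝ) : ℂ) = ((|y|⁻¹ : ℝ) : ℂ) := by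
    rw [← Complex.ofReal_mul]
    congr 1
    have hex : Real.exp (-τ / 2) ≠ 0 := (Real.exp_pos _).ne'
    field_simp
  calc f τ * ((Real.exp (-τ / 2) : ℂ) * (F (Real.exp (-τ) * y) *
          (ψ (-τ) * (((Real.exp (-τ / 2) * |y|)⁻¹ : ℝ) : ℂ))))
        = (Real.exp (-τ / 2) : ℂ) * (((Real.exp (-τ / 2) * |y|)⁻¹ : ℝ) : ℂ) *
          (f τ * ψ (-τ) * F (Real.exp (-τ) * y)) := by ring
    _ = ((|y|⁻¹ : ℝ) : ℂ) * (f τ * ψ (-τ) * F (Real.exp (-τ) * y)) := by rw [hexp]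

/-- **With the shells**: for `y ∈ Q = Q_{a,b}` and `Q' = Q_{a',b'}` containing `e^{−τ}y` whenever `f(τ) ≠ 0`,
`∫ k_f^{Q'}(y, v) k_ψ^{Q}(v, y) dv = |y|⁻¹ ∫ f(τ) ψ(−τ) dτ`. [cite: Connes1999, §VII proof of Thm 4 eqs. (29)–(33) (arXiv p0013)] -/
theorem integral_shellScalingKernel_mul_shellScalingKernel (f ψ : ℝ → ℂ) {a b a' b' y : ℝ} (ha : 0 < a)
    (hy : y ∈ shellSet a b) (hQ' : ∀ τ, f τ ≠ 0 → Real.exp (-τ) * y ∈ shellSet a' b') :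
    ∫ v, shellScalingKernel f a' b' y v * shellScalingKernel ψ a b v y =
      ((|y|⁻¹ : ℝ) : ℂ) * ∫ τ, f τ * ψ (-τ) := by
  have hy0 : y ≠ 0 := by
    intro h; rw [h, mem_shellSet_iff, abs_zero] at hy; exact (lt_irrefl _ (ha.trans hy.1)).elim
  have h1 : (fun v => shellScalingKernel f a' b' y v * shellScalingKernel ψ a b v y) = fun v =>
      scalingKernel f y v * ((shellSet a' b').indicator (fun _ => (1 : ℂ)) v * scalingKernel ψ v y) := by
    funext v
    rw [shellScalingKernel_eq, shellScalingKernel_eq, Set.indicator_of_mem hy, mul_one]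
    ring
  rw [h1, integral_scalingKernel_mul_mul_scalingKernel f ψ _ hy0]
  congr 1
  refine integral_congr_ae (ae_of_all _ fun τ => ?_)
  show f τ * ψ (-τ) * (shellSet a' b').indicator (fun _ => (1 : ℂ)) (Real.exp (-τ) * y) = f τ * ψ (-τ)
  by_cases hf : f τ = 0
  · simp only [hf, zero_mul]
  · rw [Set.indicator_of_mem (hQ' τ hf), mul_one]

/-- Off the shell the integrand vanishes identically. [cite: Connes1999, §VII eq. (12) (arXiv p0013)] -/
theorem shellScalingKernel_mul_shellScalingKernel_of_notMem (f ψ : ℝ → ℂ) {a b a' b' y : ℝ}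
    (hy : y ∉ shellSet a b) (v : ℝ) :
    shellScalingKernel f a' b' y v * shellScalingKernel ψ a b v y = 0 := by
  rw [shellScalingKernel_eq ψ, Set.indicator_of_notMem hy, mul_zero, mul_zero]

/-! ## §2. The outer integral `∫_Q dy/|y| = 2 log(b/a)` -/

/-- **`∫_{Q_{a,b}} dy/|y| = 2 log(b/a)`** for `0 < a ≤ b` (the two halves `(a,b]` and `[−b,−a)` each give
`log(b/a)`). [cite: Connes1999, §VII proof of Thm 4 eq. (33) (arXiv p0013)] -/
theorem integral_shellSet_abs_inv {a b : ℝ} (ha : 0 < a) (hab : a ≤ b) :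
    ∫ y in shellSet a b, ((|y|⁻¹ : ℝ) : ℂ) = ((2 * Real.log (b / a) : ℝ) : ℂ) := by
  have hb : 0 < b := ha.trans_le hab
  -- `Q = (a, b] ∪ [−b, −a)`, disjointly
  have hQ : shellSet a b = Set.Ioc a b ∪ Set.Ico (-b) (-a) := by
    ext y
    simp only [mem_shellSet_iff, Set.mem_union, Set.mem_Ioc, Set.mem_Ico]
    rcases le_or_gt 0 y with h | h
    · rw [abs_of_nonneg h]
      constructor
      · intro ⟨h1, h2⟩; exact Or.inl ⟨h1, h2⟩
      · rintro (⟨h1, h2⟩ | ⟨h1, h2⟩)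
        · exact ⟨h1, h2⟩
        · linarith
    · rw [abs_of_neg h]
      constructor
      · intro ⟨h1, h2⟩; exact Or.inr ⟨by linarith, by linarith⟩
      · rintro (⟨h1, h2⟩ | ⟨h1, h2⟩)
        · linarith
        · exact ⟨by linarith, by linarith⟩
  have hdisj : Disjoint (Set.Ioc a b) (Set.Ico (-b) (-a)) := by
    rw [Set.disjoint_left]
    intro y hy hy'
    have := hy.1; have := hy'.2; linarith
  -- integrability of `|y|⁻¹` on both pieces (bounded by `a⁻¹` on sets of finite measure)
  have hbound : ∀ y ∈ shellSet a b, ‖((|y|⁻¹ : ℝ) : ℂ)‖ ≤ a⁻¹ := fun y hy => by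
    rw [Complex.norm_real, Real.norm_eq_abs, abs_inv, abs_abs]
    exact inv_anti₀ ha hy.1.le
  have hmeas : AEStronglyMeasurable (fun y : ℝ => ((|y|⁻¹ : ℝ) : ℂ)) volume :=
    (Complex.continuous_ofReal.measurable.comp (measurable_inv.comp measurable_abs)).aestronglyMeasurable
  have hint : ∀ s ⊆ shellSet a b, MeasurableSet s → volume s < ⊤ →
      IntegrableOn (fun y : ℝ => ((|y|⁻¹ : ℝ) : ℂ)) s volume := fun s hs hsm hsv =>
    Measure.integrableOn_of_bounded hsv.ne hmeas
      ((ae_restrict_iff' hsm).mpr (ae_of_all _ fun y hy => hbound y (hs hy)))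
  have hI1 : IntegrableOn (fun y : ℝ => ((|y|⁻¹ : ℝ) : ℂ)) (Set.Ioc a b) volume :=
    hint _ (hQ ▸ Set.subset_union_left) measurableSet_Ioc (by simp)
  have hI2 : IntegrableOn (fun y : ℝ => ((|y|⁻¹ : ℝ) : ℂ)) (Set.Ico (-b) (-a)) volume :=
    hint _ (hQ ▸ Set.subset_union_right) measurableSet_Ico (by simp)
  rw [hQ, setIntegral_union hdisj measurableSet_Ico hI1 hI2]
  -- first half: `∫_{(a,b]} dy/y = log(b/a)`
  have e1 : ∫ y in Set.Ioc a b, ((|y|⁻¹ : ℝ) : ℂ) = ((Real.log (b / a) : ℝ) : ℂ) := by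
    rw [← intervalIntegral.integral_of_le hab]
    have h1 : ∫ y in a..b, ((|y|⁻¹ : ℝ) : ℂ) = ∫ y in a..b, ((y⁻¹ : ℝ) : ℂ) := by
      refine intervalIntegral.integral_congr fun y hy => ?_
      rw [Set.uIcc_of_le hab] at hy
      simp only [abs_of_pos (ha.trans_le hy.1)]
    rw [h1, intervalIntegral.integral_ofReal, integral_inv_of_pos ha hb]
  -- second half: `y ↦ −y`
  have e2 : ∫ y in Set.Ico (-b) (-a), ((|y|⁻¹ : ℝ) : ℂ) = ((Real.log (b / a) : ℝ) : ℂ) := by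
    rw [integral_Ico_eq_integral_Ioo, ← integral_Ioc_eq_integral_Ioo,
      ← intervalIntegral.integral_of_le (by linarith : -b ≤ -a)]
    have h1 : ∫ y in (-b)..(-a), ((|y|⁻¹ : ℝ) : ℂ) = ∫ y in (-b)..(-a), -(((y⁻¹ : ℝ) : ℂ)) := by
      refine intervalIntegral.integral_congr fun y hy => ?_
      rw [Set.uIcc_of_le (by linarith : -b ≤ -a)] at hy
      have hyneg : y < 0 := by have := hy.2; linarith
      simp only [abs_of_neg hyneg, inv_neg, Complex.ofReal_neg]
    rw [h1, intervalIntegral.integral_neg, intervalIntegral.integral_ofReal,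
      integral_inv_of_neg (by linarith) (by linarith), ← Complex.ofReal_neg, ← Real.log_inv]
    congr 2
    rw [neg_div_neg_eq, inv_div]
  rw [e1, e2, ← Complex.ofReal_add]
  congr 1
  ring

/-! ## §3. The double integral -/

/-- **The trace integral**: for `0 < a ≤ b` and `Q' = Q_{a',b'} ∋ e^{−τ}y` whenever `f(τ) ≠ 0`, `y ∈ Q_{a,b}`,
`∫ (∫ k_f^{Q'}(y, v) k_ψ^{Q}(v, y) dv) dy = 2 log(b/a) ∫ f(τ) ψ(−τ) dτ` (`= 2 log(b/a) (f ⋆ ψ)(0)`). [cite: Connes1999, §VII proof of Thm 4 eqs. (29)–(33) (arXiv p0013)] -/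
theorem integral_integral_shellScalingKernel_mul (f ψ : ℝ → ℂ) {a b a' b' : ℝ} (ha : 0 < a) (hab : a ≤ b)
    (hQ' : ∀ τ, f τ ≠ 0 → ∀ y ∈ shellSet a b, Real.exp (-τ) * y ∈ shellSet a' b') :
    ∫ y, ∫ v, shellScalingKernel f a' b' y v * shellScalingKernel ψ a b v y =
      ((2 * Real.log (b / a) : ℝ) : ℂ) * ∫ τ, f τ * ψ (-τ) := by
  have h1 : (fun y => ∫ v, shellScalingKernel f a' b' y v * shellScalingKernel ψ a b v y) =
      fun y => (shellSet a b).indicator (fun y => ((|y|⁻¹ : ℝ) : ℂ)) y * ∫ τ, f τ * ψ (-τ) := by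
    funext y
    by_cases hy : y ∈ shellSet a b
    · rw [integral_shellScalingKernel_mul_shellScalingKernel f ψ ha hy (fun τ hτ => hQ' τ hτ y hy),
        Set.indicator_of_mem hy]
    · simp only [shellScalingKernel_mul_shellScalingKernel_of_notMem f ψ hy, integral_zero,
        Set.indicator_of_notMem hy, zero_mul]
  rw [h1, integral_mul_const, integral_indicator (measurableSet_shellSet a b), integral_shellSet_abs_inv ha hab]

/-! ## §4. The same with the support condition on `ψ` (the form produced by the Dixmier–Malliavin split,
where the enlarged shell `Q'` is adapted to the support of the inner factor `ψ`) -/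

/-- **With the shells, support condition on the product `f(τ)ψ(−τ)`**: for `y ∈ Q = Q_{a,b}` and `Q' = Q_{a',b'}`
containing `e^{−τ}y` whenever `f(τ) ≠ 0` and `ψ(−τ) ≠ 0`, `∫ k_f^{Q'}(y, v) k_ψ^{Q}(v, y) dv = |y|⁻¹ ∫ f(τ) ψ(−τ) dτ`. [cite: Connes1999, §VII proof of Thm 4 eqs. (29)–(33) (arXiv p0013)] -/
theorem integral_shellScalingKernel_mul_shellScalingKernel' (f ψ : ℝ → ℂ) {a b a' b' y : ℝ} (ha : 0 < a)
    (hy : y ∈ shellSet a b) (hQ' : ∀ τ, f τ ≠ 0 → ψ (-τ) ≠ 0 → Real.exp (-τ) * y ∈ shellSet a' b') :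
    ∫ v, shellScalingKernel f a' b' y v * shellScalingKernel ψ a b v y =
      ((|y|⁻¹ : ℝ) : ℂ) * ∫ τ, f τ * ψ (-τ) := by
  have hy0 : y ≠ 0 := by
    intro h; rw [h, mem_shellSet_iff, abs_zero] at hy; exact (lt_irrefl _ (ha.trans hy.1)).elim
  have h1 : (fun v => shellScalingKernel f a' b' y v * shellScalingKernel ψ a b v y) = fun v =>
      scalingKernel f y v * ((shellSet a' b').indicator (fun _ => (1 : ℂ)) v * scalingKernel ψ v y) := by
    funext v
    rw [shellScalingKernel_eq, shellScalingKernel_eq, Set.indicator_of_mem hy, mul_one]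
    ring
  rw [h1, integral_scalingKernel_mul_mul_scalingKernel f ψ _ hy0]
  congr 1
  refine integral_congr_ae (ae_of_all _ fun τ => ?_)
  show f τ * ψ (-τ) * (shellSet a' b').indicator (fun _ => (1 : ℂ)) (Real.exp (-τ) * y) = f τ * ψ (-τ)
  by_cases hf : f τ = 0
  · simp only [hf, zero_mul]
  · by_cases hψ : ψ (-τ) = 0
    · simp only [hψ, mul_zero, zero_mul]
    · rw [Set.indicator_of_mem (hQ' τ hf hψ), mul_one]

/-- **The trace integral, support condition on `f(τ)ψ(−τ)`**: for `0 < a ≤ b` and `Q' = Q_{a',b'} ∋ e^{−τ}y`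
whenever `f(τ) ≠ 0`, `ψ(−τ) ≠ 0`, `y ∈ Q_{a,b}`:
`∫ (∫ k_f^{Q'}(y, v) k_ψ^{Q}(v, y) dv) dy = 2 log(b/a) ∫ f(τ) ψ(−τ) dτ`.  With `ψ` supported in `[−R, R]` the
shell `Q' = Q_{a e^{−R}, b e^{R}}` of `AnnulusFamilySplit.exists_scalingOp_shellProj_eq_sum` qualifies
(`integral_integral_shellScalingKernel_mul_of_support`). [cite: Connes1999, §VII proof of Thm 4 eqs. (29)–(33) (arXiv p0013)] -/
theorem integral_integral_shellScalingKernel_mul' (f ψ : ℝ → ℂ) {a b a' b' : ℝ} (ha : 0 < a) (hab : a ≤ b)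
    (hQ' : ∀ τ, f τ ≠ 0 → ψ (-τ) ≠ 0 → ∀ y ∈ shellSet a b, Real.exp (-τ) * y ∈ shellSet a' b') :
    ∫ y, ∫ v, shellScalingKernel f a' b' y v * shellScalingKernel ψ a b v y =
      ((2 * Real.log (b / a) : ℝ) : ℂ) * ∫ τ, f τ * ψ (-τ) := by
  have h1 : (fun y => ∫ v, shellScalingKernel f a' b' y v * shellScalingKernel ψ a b v y) =
      fun y => (shellSet a b).indicator (fun y => ((|y|⁻¹ : ℝ) : ℂ)) y * ∫ τ, f τ * ψ (-τ) := by
    funext y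
    by_cases hy : y ∈ shellSet a b
    · rw [integral_shellScalingKernel_mul_shellScalingKernel' f ψ ha hy (fun τ hτ hψ => hQ' τ hτ hψ y hy),
        Set.indicator_of_mem hy]
    · simp only [shellScalingKernel_mul_shellScalingKernel_of_notMem f ψ hy, integral_zero,
        Set.indicator_of_notMem hy, zero_mul]
  rw [h1, integral_mul_const, integral_indicator (measurableSet_shellSet a b), integral_shellSet_abs_inv ha hab]

/-- **The trace integral for `ψ` supported in `[−R, R]` and `Q' = Q_{a e^{−R}, b e^{R}}`**:
`∫ (∫ k_f^{Q'}(y, v) k_ψ^{Q}(v, y) dv) dy = 2 log(b/a) ∫ f(τ) ψ(−τ) dτ`. [cite: Connes1999, §VII proof of Thm 4 eqs. (29)–(33) (arXiv p0013)] -/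
theorem integral_integral_shellScalingKernel_mul_of_support (f ψ : ℝ → ℂ) {a b R : ℝ} (ha : 0 < a)
    (hab : a ≤ b) (hR : ∀ τ, R < |τ| → ψ τ = 0) :
    ∫ y, ∫ v, shellScalingKernel f (a * Real.exp (-R)) (b * Real.exp R) y v * shellScalingKernel ψ a b v y =
      ((2 * Real.log (b / a) : ℝ) : ℂ) * ∫ τ, f τ * ψ (-τ) := by
  refine integral_integral_shellScalingKernel_mul' f ψ ha hab fun τ _ hψ y hy => ?_
  -- `|τ| ≤ R` (else `ψ(−τ) = 0`), so `a e^{−R} ≤ a e^{−τ} < e^{−τ}|y| ≤ e^{−τ} b ≤ b e^{R}`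
  have hτ : |τ| ≤ R := by
    by_contra h
    exact hψ (hR (-τ) (by rw [abs_neg]; exact lt_of_not_ge h))
  have hτ1 : -R ≤ τ ∧ τ ≤ R := abs_le.mp hτ
  rw [mem_shellSet_iff] at hy ⊢
  rw [abs_mul, abs_of_pos (Real.exp_pos _)]
  have he1 : Real.exp (-R) ≤ Real.exp (-τ) := Real.exp_le_exp.mpr (by linarith)
  have he2 : Real.exp (-τ) ≤ Real.exp R := Real.exp_le_exp.mpr (by linarith)
  have hepos : 0 < Real.exp (-τ) := Real.exp_pos _
  constructor
  · calc a * Real.exp (-R) ≤ a * Real.exp (-τ) := mul_le_mul_of_nonneg_left he1 ha.le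
      _ = Real.exp (-τ) * a := mul_comm _ _
      _ < Real.exp (-τ) * |y| := mul_lt_mul_of_pos_left hy.1 hepos
  · calc Real.exp (-τ) * |y| ≤ Real.exp (-τ) * b := mul_le_mul_of_nonneg_left hy.2 hepos.le
      _ ≤ Real.exp R * b := mul_le_mul_of_nonneg_right he2 (ha.le.trans hab)
      _ = b * Real.exp R := mul_comm _ _

end Literature.NumberTheory.Connes2026
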